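import Literature.Probability.RandomPlanarGeometry.HexSAWBrickWallBridgeEnvelope
import Literature.Probability.RandomPlanarGeometry.HexSAWBridgeInsertion
import Literature.Probability.RandomPlanarGeometry.HexSAWRatioRate
import HarnessLib

/-!
# Kesten's exponent on the hexagonal lattice: `|c_{N+2}(ℍ)/c_N(ℍ) − (2+√2)| ≤ K N^{-1/3}` for every `N ≥ 1`

Topic `Literature/Probability/RandomPlanarGeometry` (continues `HexSAWRatioRate.lean`: the mixed rate
`−K N^{-1/4} ≤ c_{N+2}(ℍ)/c_N(ℍ) − (2+√2) ≤ K N^{-1/3}` and the two-sided `N^{-1/3}` rate MODULO an insertion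
inequality and a lower envelope for an auxiliary count, `hexRatioTwo_rate_cubeRoot_of`;
`HexSAWBrickWallBridgeEnvelope.lean`: the length-indexed lower envelope `e^{-9√M} μ_ℍ^{2M} ≤ μ_ℍ b_{2M}(ℍ)`
for the brick-wall bridges of `ℍ`; `HexSAWBridgeInsertion.lean`: the even-bridge insertion inequality
`c_n(ℍ) b_{2M}(ℍ) ≤ (n+1) c_{n+2M}(ℍ)`).

Sources: N. Madras, G. Slade, *The Self-Avoiding Walk* (1993), §7.5, eqs. (7.5.1)–(7.5.2): on `ℤ^d`,
`|c_{N+2}/c_N − μ²| ≤ K N^{-1/3}` (H. Kesten, *On the number of self-avoiding walks*, J. Math. Phys. 4 (1963)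
960–969), printed without proof; our lower side uses an insertion inequality with polynomial loss (not in
print; cf. the bridge-splice idea of M–S §3.1) and the Hammersley–Welsh lower envelope
`b_N ≥ μ^{N−1} e^{−B√N}` (Corollary 3.1.6, (3.1.9), p. 61).  H. Duminil-Copin, S. Smirnov, Ann. of Math. 175 (2012), Theorem 1
(`μ_ℍ² = 2 + √2`).  Nothing is printed for `ℍ`: this file upgrades the lane's lower exponent `1/4` (envelope
route, `hexRatioTwo_rate_mixed`) to Kesten's `1/3` by inserting EVEN brick-wall bridges at the last maximum of
the height (reflection splice, `HexBW.hexSawCount_mul_bridgeCount_two_mul_le_real`) and the double-unfolding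
lower envelope for those bridges (`HexBW.exp_neg_mul_sqrt_mul_pow_le_bridgeCount`).  The lower envelope
was independently kernel-checked by a second text in the lane (seat a-p2, a different route: cut at the last
minimum, concatenation, one unfolding; constants `c = 9√2`, `A = 1`), kept outside the tree.

## Main statement (namespace `Literature.Probability.RandomPlanarGeometry.SAW`)

* UNCONDITIONAL **`hexRatioTwo_rate_cubeRoot : ∃ K, ∀ N ≥ 1, |c_{N+2}(ℍ)/c_N(ℍ) − (2+√2)| ≤ K · N^{-1/3}`**
  (`hexRatioTwo_rate_cubeRoot_of` fed by the tree theorems `hexSawCount_le_add_four`, `HV.KestenIneqHex_holds`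
  and the two brick-wall inputs with `e M := b_{2M}(ℍ)`, `c = 9`, `A = μ_ℍ`).
-/

noncomputable section

open Filter Topology Finset

namespace Literature.Probability.RandomPlanarGeometry.SAW

/-- **Kesten's exponent on the hexagonal lattice, unconditionally**: there is `K` with
`|c_{N+2}(ℍ)/c_N(ℍ) − (2+√2)| ≤ K · N^{-1/3}` for every `N ≥ 1` — the tree's `hexRatioTwo_rate_cubeRoot_of`
(K3-ℍ `hexSawCount_le_add_four`, Kesten's inequality `HV.KestenIneqHex_holds`, the abstract `1/3` engine) run with
the auxiliary count `e M := b_{2M}(ℍ)` = the even brick-wall bridges of `ℍ`: lower envelope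
`HexBW.exp_neg_mul_sqrt_mul_pow_le_bridgeCount` (`c = 9`, `A = μ_ℍ`) and insertion inequality
`HexBW.hexSawCount_mul_bridgeCount_two_mul_le_real`.  Printed for `ℤ^d` only (Kesten 1963, Madras–Slade (7.5.1),
without proof); not in print for `ℍ`. [cite: MadrasSlade1993, §7.5 eq. (7.5.1)–(7.5.2); DuminilCopinSmirnov2012, Thm 1] -/
theorem hexRatioTwo_rate_cubeRoot : ∃ K : ℝ, ∀ N : ℕ, 1 ≤ N →
    |(hexSawCount (N + 2) : ℝ) / hexSawCount N - (2 + Real.sqrt 2)| ≤ K * (N : ℝ) ^ (-(1 : ℝ) / 3) :=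
  hexRatioTwo_rate_cubeRoot_of hexSawCount_le_add_four HV.KestenIneqHex_holds
    (e := fun M => (HexBW.bridgeCount (2 * M) : ℝ)) (c := 9) (A := hexConnectiveConstant) (by norm_num)
    HexRate.hexConnectiveConstant_facts.2.1
    (fun M hM => HexBW.exp_neg_mul_sqrt_mul_pow_le_bridgeCount M (by omega))
    HexBW.hexSawCount_mul_bridgeCount_two_mul_le_real

end Literature.Probability.RandomPlanarGeometry.SAW
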